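import Literature.MathematicalPhysics.StatisticalMechanics.BarlowStacking
import Summits.AtomisticToContinuum.Crystallization.Theorems.ChargedEnergyGap.Negative.BlocksBound
import HarnessLib

/-!
# Crux `PatternPricedCertificates` (stmt-AtomisticToContinuum-12974), line `registered`: hcp uniqueness from a unique minimiser

Stub B5 (`stub_hcpUnique`: the exactly minimising hcp stackings of the box `[1/2,2]²` are one isometry class) follows from the
box-local statement that the Lennard-Jones energy per particle of the hcp family has a UNIQUE minimiser on the box (the certified-numerics
content; numerically `c = h/a ≈ 0.816`, `a⋆ ≈ 0.971`, `h⋆ ≈ 0.793`): since `e⋆ ≤ e(hcp a h)` always, an hcp stacking attaining `e⋆` is a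
minimiser of the family, hence THE minimiser. `[folklore]`
-/

noncomputable section

namespace Summit.AtomisticToContinuum.Crystallization.Theorems.PatternPricedCertificates

open Literature.MathematicalPhysics.StatisticalMechanics (lennardJones PeriodicConfiguration hcpPeriodicConfiguration hcpStacking)

/-- **hcp uniqueness from a unique minimiser of the hcp family on the box.** If some `(a₀, h₀) ∈ [1/2,2]²` beats-or-ties no other
parameter pair of the box except itself (`e(hcp a h) ≤ e(hcp a₀ h₀) ⇒ (a, h) = (a₀, h₀)`), then every hcp stacking of the box attaining
`e⋆ = ⨅_Q e(Q)` is (the identity image of) `P.points` for `P := hcp(a₀, h₀)`. [folklore] -/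
theorem hcpUnique_of_uniqueMinimiser :
    (∃ (a₀ h₀ : ℝ) (ha₀ : a₀ ≠ 0) (hh₀ : h₀ ≠ 0), 1 / 2 ≤ a₀ ∧ a₀ ≤ 2 ∧ 1 / 2 ≤ h₀ ∧ h₀ ≤ 2 ∧
      ∀ (a h : ℝ) (ha : a ≠ 0) (hh : h ≠ 0), 1 / 2 ≤ a → a ≤ 2 → 1 / 2 ≤ h → h ≤ 2 →
        (hcpPeriodicConfiguration ha hh).energyPerParticle lennardJones ≤ (hcpPeriodicConfiguration ha₀ hh₀).energyPerParticle lennardJones →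
        a = a₀ ∧ h = h₀) →
    ∃ P : PeriodicConfiguration 3, ∀ (a h : ℝ) (ha : a ≠ 0) (hh : h ≠ 0), 1 / 2 ≤ a → a ≤ 2 → 1 / 2 ≤ h → h ≤ 2 →
      (hcpPeriodicConfiguration ha hh).energyPerParticle lennardJones = (⨅ Q : PeriodicConfiguration 3, Q.energyPerParticle lennardJones) →
      ∃ L : (EuclideanSpace ℝ (Fin 3)) ≃ₗᵢ[ℝ] (EuclideanSpace ℝ (Fin 3)), (⇑L) '' P.points = hcpStacking a h := by
  rintro ⟨a₀, h₀, ha₀, hh₀, ha₁, ha₂, hh₁, hh₂, huniq⟩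
  refine ⟨hcpPeriodicConfiguration ha₀ hh₀, fun a h ha hh h1 h2 h3 h4 heq => ?_⟩
  have hle : (hcpPeriodicConfiguration ha hh).energyPerParticle lennardJones ≤
      (hcpPeriodicConfiguration ha₀ hh₀).energyPerParticle lennardJones := by
    rw [heq]
    exact Summit.AtomisticToContinuum.Crystallization.Theorems.ChargedEnergyGapNegative.eStar_le _
  obtain ⟨rfl, rfl⟩ := huniq a h ha hh h1 h2 h3 h4 hle
  refine ⟨LinearIsometryEquiv.refl ℝ (EuclideanSpace ℝ (Fin 3)), ?_⟩
  rw [Literature.MathematicalPhysics.StatisticalMechanics.hcpPeriodicConfiguration_points]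
  simp

end Summit.AtomisticToContinuum.Crystallization.Theorems.PatternPricedCertificates

end
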